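import Mathlib
import HarnessLib
import Summits.QuantumFields.YangMills.Theses.PencilRigidity
import Literature.MathematicalPhysics.QuantumLattice.WilsonLoops
import Literature.MathematicalPhysics.QuantumFieldTheory.LatticeGaugeProofs

/-!
# Crux-triage scratch (triager r1-2): the typed first lemma `ChargedSectorsAreHeavy` of card
`ungauged-transfer-gap` (Cruxes/HypercubicLimit/SketchIdeator2.lean) is FALSE as typed —
it quantifies over every compact `G` and every faithful unitary `r`, including representations
with a trivial summand (witness: `G = PUnit`, `r` = the 1-dimensional trivial representation,
where every Wilson loop has expectation `1 = r.N`, but the bound forces `1 ≤ 1 - C`).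
Repair: restrict to `r` without non-zero invariant vectors (e.g. irreducible non-trivial), or
bound `⟨W⟩ - (multiplicity of the trivial representation in r)`.
-/

open MeasureTheory Filter Topology
open Literature.MathematicalPhysics.QuantumLattice Literature.MathematicalPhysics.QuantumFieldTheory

namespace CruxTriage

/-- Verbatim copy of `Summit.QuantumFields.YangMills.Cruxes.HypercubicLimit.Sketch.ChargedSectorsAreHeavy`. -/
def ChargedSectorsAreHeavy : Prop :=
  ∀ (G : Type) [Group G] [TopologicalSpace G] [IsTopologicalGroup G] [CompactSpace G]
    [MeasurableSpace G] [BorelSpace G] (r : LatticeRep G),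
    ∃ C : ℝ, 0 < C ∧ ∀ β : ℝ, 1 ≤ β → ∀ (S l t : ℕ), 1 ≤ l → 1 ≤ t →
      |∫ U, wilsonLoopObs (fun g => (r.ρ g).trace.re)
            (rectWalk (0 : Literature.Probability.LatticeModels.Site 4) 0 1 l t)
            (torusLift (2 * S + 1) U)
          ∂(wilsonMeasure (d := 4) (L := 2 * S + 1) r.ρ β)|
        ≤ (r.N : ℝ) * (1 - C / β ^ 2) ^ (t - 1)

/-- The trivial group's faithful continuous unitary 1-dimensional representation. -/
def punitRep : LatticeRep PUnit :=
  ⟨1, 1, continuous_const, fun a b _ => Subsingleton.elim a b, fun _ => by simp⟩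

theorem not_chargedSectorsAreHeavy : ¬ ChargedSectorsAreHeavy := by
  intro h
  letI : MeasurableSpace PUnit := borel PUnit
  haveI : BorelSpace PUnit := ⟨rfl⟩
  obtain ⟨C, hC, hb⟩ := h PUnit punitRep
  have key := hb 1 le_rfl 1 1 2 le_rfl (by norm_num)
  haveI : IsProbabilityMeasure (wilsonMeasure (d := 4) (L := 2 * 1 + 1) punitRep.ρ 1) :=
    isProbabilityMeasure_wilsonMeasure (d := 4) (L := 2 * 1 + 1) punitRep.ρ punitRep.continuous 1
  have hint : ∫ U, wilsonLoopObs (fun g => (punitRep.ρ g).trace.re)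
      (rectWalk (0 : Literature.Probability.LatticeModels.Site 4) 0 1 1 2)
      (torusLift (2 * 1 + 1) U) ∂(wilsonMeasure (d := 4) (L := 2 * 1 + 1) punitRep.ρ 1) = 1 := by
    have h1 : ∀ g : PUnit.{1}, punitRep.ρ g = 1 := fun _ => rfl
    have hconst : ∀ U : GaugeConfig 4 (2 * 1 + 1) PUnit.{1},
        wilsonLoopObs (fun g => (punitRep.ρ g).trace.re)
          (rectWalk (0 : Literature.Probability.LatticeModels.Site 4) 0 1 1 2)
          (torusLift (2 * 1 + 1) U) = 1 := by
      intro U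
      simp only [wilsonLoopObs, h1, Matrix.trace_one]
      simp [punitRep]
    simp_rw [hconst]
    simp
  rw [hint] at key
  have hN : (punitRep.N : ℝ) = 1 := by simp [punitRep]
  rw [hN] at key
  norm_num at key
  linarith [abs_nonneg (1 : ℝ)]

end CruxTriage
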